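import Literature.Probability.RandomPlanarGeometry.LoewnerRealKoebe
import Literature.Probability.RandomPlanarGeometry.SLEKappaRho
import HarnessLib

/-!
# No positive real point in `cl K_∞` from bounds on `log g_t'(x) - log g_t'(y)`: the hull form of the Koebe route

Deterministic step of a proof of the named fact
`Literature.Probability.RandomPlanarGeometry.SLEKappaRho.ae_forall_ofReal_notMem_closure_hullUnion`
(`SLEKappaRhoFillVersion`: for SLE(8/3, ρ), a.s. no point of `(0, ∞)` lies in the closure of
`K_∞ = ⋃ₜ K_t`, [LSW] Lemma 8.3 (2)–(3) with Thm. 8.4), after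

* S. Rohde, O. Schramm, *Basic properties of SLE*, Ann. of Math. **161** (2005), proof of
  Lemma 7.2 (p. 909): "it suffices to show that a.s. `sup_{t ≥ 0} Q(t) < ∞`" with the Koebe
  bound "the distance from `x` to `∂D_t` is at least `¼ (g_t(x) - g_t(y))/g_t'(x)`";
* G. F. Lawler, O. Schramm, W. Werner, *Conformal restriction: the chordal case*, J. Amer. Math.
  Soc. **16** (2003), Lemma 8.3 (p. 36) and Thm. 8.4 (p. 37).

The tree's `SLERealAvoidance` runs this route for chains GENERATED BY A CURVE
(`Loewner.IsGeneratedByCurve.ofReal_notMem_closure_range_of_bounds`). The SLE(κ, ρ) chains of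
[LSW] §8.3 are not known (in the tree) to be generated by a curve, so we record the same
deduction for the HULLS of an arbitrary continuous driving function, using the hull form of the
Koebe bound already in the tree (`Loewner.le_dist_ofReal_of_mem_hull`, `LoewnerRealKoebe`):

* `Loewner.ofReal_notMem_closure_hullUnion_of_bounds` — for a continuous `W` with `W 0 = 0`, if no
  positive rational is ever swallowed and for all rationals `0 < q < q'` the non-decreasing
  function `t ↦ log |g_t'(q')| - log |g_t'(q)|` is bounded, then NO positive real point lies in
  `cl (⋃ₜ K_t)` (`Loewner.hullUnion`): for `x > 0` pick rationals `0 < q < x < q'` and a bound `L`;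
  every hull point is at distance `≥ (x - q) e^{-L}/4` from `x`;
* `Loewner.ae_forall_ofReal_notMem_closure_hullUnion_of_bounds` — the almost-sure packaging for a
  driving PROCESS (time first, any measure): a.s. continuity with `W_0 = 0`, a.s. non-swallowing
  of each `y > 0`, and for each pair `0 < y < x` an a.s. bound, give: a.s., for every real
  `x > 0`, `x ∉ cl K_∞` (countably many instances at rational points).

No named fact is introduced; the stochastic inputs for SLE(κ, ρ) are supplied downstream.
-/

noncomputable section

open Set Filter Topology MeasureTheory Metric Complex
open scoped NNReal

namespace Literature.Probability.RandomPlanarGeometry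

namespace Loewner

variable {W : ℝ≥0 → ℝ}

/-- **Every hull point is far from `x`**: for a continuous `W` with `W 0 < q < x ≤ q'`, `t < T_q`
and `log |g_t'(q')| - log |g_t'(q)| ≤ L`, every point of the hull `K_t` is at distance at least
`(x - q) e^{-L} / 4` from `x` (Koebe bound `le_dist_ofReal_of_mem_hull` at `x` relative to `q`,
mean-value bound `sub_mul_norm_deriv_le_map_sub`, monotonicity `norm_deriv_map_ofReal_mono`).
[cite: RohdeSchramm2005, proof of Lemma 7.2 (p. 909)] -/
theorem le_dist_of_mem_hull_of_log_deriv_le (hW : Continuous W) {q x q' L : ℝ} (hq : W 0 < q)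
    (hqx : q < x) (hxq' : x ≤ q') {t : ℝ≥0} (ht : (t : WithTop ℝ≥0) < swallowingTime W q)
    (hL : Real.log ‖deriv (map W t) q'‖ - Real.log ‖deriv (map W t) q‖ ≤ L) {w : ℂ}
    (hw : w ∈ hull W t) : (x - q) * Real.exp (-L) / 4 ≤ dist w x := by
  have hxW : W 0 < x := hq.trans hqx
  have hq'W : W 0 < q' := hxW.trans_le hxq'
  have htx : (t : WithTop ℝ≥0) < swallowingTime W x :=
    lt_of_lt_of_le ht (swallowingTime_mono_right hW hq hqx.le)
  have htq' : (t : WithTop ℝ≥0) < swallowingTime W q' :=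
    lt_of_lt_of_le ht (swallowingTime_mono_right hW hq (hqx.le.trans hxq'))
  have h1 := le_dist_ofReal_of_mem_hull hW hq ht hqx hw
  have h2 := sub_mul_norm_deriv_le_map_sub hW hq hqx.le ht
  have h3 := norm_deriv_map_ofReal_mono hW hxW hxq' htx
  have hposq := norm_deriv_map_ofReal_pos hW hq ht
  have hposx := norm_deriv_map_ofReal_pos hW hxW htx
  have hposq' := norm_deriv_map_ofReal_pos hW hq'W htq'
  have hratio : Real.exp (-L) ≤ ‖deriv (map W t) q‖ / ‖deriv (map W t) q'‖ := by
    rw [le_div_iff₀ hposq', ← Real.exp_log hposq, ← Real.exp_log hposq', ← Real.exp_add]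
    exact Real.exp_le_exp.2 (by linarith)
  have hxq : 0 < x - q := sub_pos.2 hqx
  calc (x - q) * Real.exp (-L) / 4
      ≤ (x - q) * (‖deriv (map W t) q‖ / ‖deriv (map W t) q'‖) / 4 := by gcongr
    _ = (x - q) * ‖deriv (map W t) q‖ / (4 * ‖deriv (map W t) q'‖) := by
        field_simp
    _ ≤ (x - q) * ‖deriv (map W t) q‖ / (4 * ‖deriv (map W t) x‖) := by
        apply div_le_div_of_nonneg_left _ (by positivity) (by linarith)
        exact mul_nonneg hxq.le (norm_nonneg _)
    _ ≤ ((map W t x).re - (map W t q).re) / (4 * ‖deriv (map W t) x‖) :=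
        div_le_div_of_nonneg_right h2 (by positivity)
    _ ≤ dist w x := h1

/-- **No positive real point in `cl K_∞` from bounds on `log g_t'(q') - log g_t'(q)`** (hull form
of Rohde–Schramm's Koebe route to Lemma 7.2, simultaneous in the point): let `W` be continuous
with `W 0 = 0`; if no positive rational is ever swallowed and for all rationals `0 < q < q'` the
function `t ↦ log |g_t'(q')| - log |g_t'(q)|` is bounded above, then for every real `x > 0`,
`x ∉ cl (⋃ₜ K_t)`. Proof: rationals `0 < q < x < q'`, a bound `L`, and
`le_dist_of_mem_hull_of_log_deriv_le` at every time. [cite: RohdeSchramm2005, proof of Lemma 7.2 (p. 909)] -/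
theorem ofReal_notMem_closure_hullUnion_of_bounds (hW : Continuous W) (hW0 : W 0 = 0)
    (hT : ∀ q : ℚ, 0 < (q : ℝ) → swallowingTime W (q : ℝ) = ⊤)
    (hP : ∀ q q' : ℚ, 0 < (q : ℝ) → (q : ℝ) < q' → ∃ L : ℝ, ∀ t : ℝ≥0,
      Real.log ‖deriv (map W t) (q' : ℝ)‖ - Real.log ‖deriv (map W t) (q : ℝ)‖ ≤ L)
    {x : ℝ} (hx : 0 < x) : (x : ℂ) ∉ closure (hullUnion W) := by
  obtain ⟨q, hq0, hqx⟩ := exists_rat_btwn hx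
  obtain ⟨q', hxq', -⟩ := exists_rat_btwn (show x < x + 1 by linarith)
  have hq0' : (0 : ℝ) < q := by exact_mod_cast hq0
  have hqq' : (q : ℝ) < q' := hqx.trans hxq'
  obtain ⟨L, hL⟩ := hP q q' hq0' hqq'
  have hqW : W 0 < q := by rw [hW0]; exact hq0'
  set r : ℝ := (x - q) * Real.exp (-L) / 4 with hr
  have hrpos : 0 < r := by
    have : 0 < x - q := sub_pos.2 hqx
    positivity
  -- every hull point is at distance `≥ r` from `x`
  have hfar : ∀ w ∈ hullUnion W, r ≤ dist w x := by
    intro w hw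
    obtain ⟨s, hws⟩ := mem_iUnion.1 hw
    have hs : (s : WithTop ℝ≥0) < swallowingTime W (q : ℝ) := by
      rw [hT q hq0']; exact WithTop.coe_lt_top s
    exact le_dist_of_mem_hull_of_log_deriv_le hW hqW hqx hxq'.le hs (hL s) hws
  rw [Metric.mem_closure_iff]
  push Not
  refine ⟨r, hrpos, fun w hw ↦ ?_⟩
  rw [dist_comm]
  exact hfar w hw

/-- **Almost-sure packaging for a driving process** `W` (time first) under any measure `P`: if
a.s. the path `t ↦ W t ω` is continuous with `W 0 ω = 0`, a.s. every `y > 0` is never swallowed,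
and for every pair `0 < y < x`, a.s. `t ↦ log |g_t'(x)| - log |g_t'(y)|` is bounded above, then
a.s. no positive real point lies in `cl (⋃ₜ K_t)`. (Countably many instances, at rational
points, of `ofReal_notMem_closure_hullUnion_of_bounds`.) [cite: RohdeSchramm2005, proof of Lemma 7.2 (p. 909)] -/
theorem ae_forall_ofReal_notMem_closure_hullUnion_of_bounds {Ω : Type*} [MeasurableSpace Ω]
    {P : Measure Ω} {W : ℝ≥0 → Ω → ℝ}
    (hc : ∀ᵐ ω ∂P, Continuous (fun t ↦ W t ω) ∧ W 0 ω = 0)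
    (hT : ∀ᵐ ω ∂P, ∀ y : ℝ, 0 < y → swallowingTime (fun t ↦ W t ω) y = ⊤)
    (hP : ∀ x y : ℝ, 0 < y → y < x → ∀ᵐ ω ∂P, ∃ L : ℝ, ∀ t : ℝ≥0,
      Real.log ‖deriv (map (fun t ↦ W t ω) t) x‖ -
        Real.log ‖deriv (map (fun t ↦ W t ω) t) y‖ ≤ L) :
    ∀ᵐ ω ∂P, ∀ x : ℝ, 0 < x → (x : ℂ) ∉ closure (hullUnion fun t ↦ W t ω) := by
  have hP' : ∀ᵐ ω ∂P, ∀ q q' : ℚ, 0 < (q : ℝ) → (q : ℝ) < q' → ∃ L : ℝ, ∀ t : ℝ≥0,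
      Real.log ‖deriv (map (fun t ↦ W t ω) t) (q' : ℝ)‖ -
        Real.log ‖deriv (map (fun t ↦ W t ω) t) (q : ℝ)‖ ≤ L := by
    rw [ae_all_iff]
    intro q
    rw [ae_all_iff]
    intro q'
    by_cases hq : 0 < (q : ℝ)
    · by_cases hqq' : (q : ℝ) < q'
      · filter_upwards [hP q' q hq hqq'] with ω hω _ _ using hω
      · exact ae_of_all _ fun ω _ h ↦ absurd h hqq'
    · exact ae_of_all _ fun ω h ↦ absurd h hq
  filter_upwards [hc, hT, hP'] with ω hcω hTω hPω x hx
  exact ofReal_notMem_closure_hullUnion_of_bounds hcω.1 hcω.2 (fun q hq ↦ hTω q hq) hPω hx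

end Loewner

end Literature.Probability.RandomPlanarGeometry

end
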